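import Summits.BirchSwinnertonDyer.Rank1Residual.Additive.DefectCountSignedSelmerMinusLine
import Summits.BirchSwinnertonDyer.Rank1Residual.Additive.DefectCountSignedSelmerRat
import Summits.BirchSwinnertonDyer.Rank1Residual.Additive.SignedTwistLocalEulerBound
import Summits.BirchSwinnertonDyer.Rank1Residual.Additive.LocalModelTransportMinusLine
import Summits.BirchSwinnertonDyer.Rank1Residual.Additive.LocalModelTransportComplement
import Summits.BirchSwinnertonDyer.Rank1Residual.Additive.SignedTwistMinusClassLayers
import Summits.BirchSwinnertonDyer.Rank1Residual.Additive.KobayashiSignedGenerationTower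
import Summits.BirchSwinnertonDyer.Rank1Residual.GaloisImage.LocalEulerPoincareCharacteristicHolds
import HarnessLib

/-!
# THE COUNT (C) OVER `ℚ` FOR THE `p*`-TWIST, ASSEMBLED: **`[A₀ : S₀] = p^ν · ∏_{ℓ ∈ T} [𝓣_ℓ : 𝓚_ℓ]`**
# with the minus line SUPPLIED (B3 at `ℚ_[p]` transported to `ℚ_{v₀}`) and Tate's local Euler
# characteristic DISCHARGED (cell `b2b-bsdres`, CLASS-CLOSURE lane, class O10 — x1b GEN 42, class
# lead; file 107 of the series: the final assembly announced in files 99–105)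

HONEST FRAMING (cell `b2b-bsdres`, run/shared/lean/b2b/bsd-rank1-residual/, verbatim in every
file): the goal of the cell is to DELETE the COMBINATION-SHAPED residual classes of the
Birch–Swinnerton-Dyer formula for ALL analytic-rank `≤ 1` elliptic curves over `ℚ` — "full BSD
formula for every rank `≤ 1` curve in class `C`" assembled STRICTLY from published theorems — so
that the rank-`≤ 1` remainder becomes exactly the CONSTRUCTION-SHAPED classes, which are TYPED
(missing-input `Prop`s), NOT attempted. This is not "finishing BSD". CLASS-CLOSURE lane: prove
what is provable now; shrink each hard class to its core with data; no claim beyond stated classes;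
research routes on CONSTRUCTION-SHAPED X12 / O10; census / instrument output = EVIDENCE / conjecture
items, NEVER a Literature fact; `RESIDUAL-MAP.md` marks change only by signed lines. THIS FILE:
TOOL THEOREMS ONLY — no definition, no named Literature fact, no Summits-side fact `def … : Prop`,
no `sorry`, axioms standard; CONDITIONAL (hypothesis `hPT`) on the NAMED FACT
`poitouTate_selmerStructure_duality_real ℚ` (Milne *ADT* I Thm. 4.10 with the real place) and on
the structural / rank-one inputs listed in the theorem; Tate's local Euler–Poincaré characteristic
(named fact `localEulerPoincareCharacteristic`, Milne I Thm. 2.8) is NOT a hypothesis any more: it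
is the tree's theorem `localEulerPoincareCharacteristic_holds` (team n1011, row T-EPC), used at
`ℚ_[p]` and at every `ℚ_v`.  Nothing is booked; no label / mark / count / sub-cell moves; (C1_η),
(C2_η-GZ), (C3_η) stay typed as filed (cc-typer-6's pen); O10 stays OPEN / CONSTRUCTION-SHAPED;
nothing about `BSD(W, p)` of any pair is claimed.

## What (x1b GEN 41 note `TRANSPORT-COUNT-x1b.md` §2 — the recipe — executed)

File 100 proves the count GIVEN at `K_{v₀}` a cyclic minus line `C` with six properties. Here, for
the `p*`-twist `W` of a globally minimal good supersingular `a_p = 0` curve `V/ℚ` (`p` odd):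
`E' = ℚ_{v₀}` (literally `Place.Completion (Sum.inr v₀)`), `E = ℚ_[p]` (Mathlib's
`Padic.adicCompletionEquiv`, both algebra structures registered under both spellings of `ℚ_{v₀}`);
the comparison element `τ` and the transport `Θ : H¹(ℚ_{v₀}, W[p^m]) ↪ H¹(ℚ_p, W[p^m])`,
`Θ ∘ loc_{v₀} = res_p` (file 101); B3 in level-`m` shape at `ℚ_[p]` (file 98) at the layer `n = 2m`
and at every higher layer — the minus lines of all layers `≥ n` COINCIDE (nested by file 106, same
order `p^m`); **`C := Θ⁻¹(Σ_p)`**; `hCcard`/`hCcyc`/`hCL` by file 104 (`#H¹(ℚ_{v₀}, W[p^m]) = p^{2m}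
= #H¹(ℚ_p, W[p^m])` by the Euler characteristic at both models; `Θ(𝓚_{v₀}) = 𝓚_p`, file 102, both
of order `p^m`); `hLC` by file 86 + file 106 + the coincidence of the lines; `hCdet` by files 94 + 85;
`hCT` by file 105; (htors) at `ℚ_[p]` / `ℚ_{v₀}`, `#(𝓞_{v₀}/p^m) = p^m`, `W[p^∞](Ē)^{Γ_E} = 0`,
divisibility and the Poitou–Tate family exactly as file 78.  RESULT
`relIndex_strictSignedSelmerLayer_localPreimage_eq_of_quadraticTwist_signedPrime`:
**`[A₀ : S₀] = p^ν · ∏_{ℓ ∈ T} [𝓣_ℓ : 𝓚_ℓ]`**, CONDITIONAL on exactly: `hPT`; the tower structure `𝓣`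
on `W[p^m]` and `𝒦_{v,0}[p^∞] = 0` off `T ∪ {v₀}`; `#A₀ ∣ p^a`; (MW); (Ш) `Ш[p^m] ⊆ Ш[p^e]`;
the exact level `ν` of `P` in `W(ℚ_{v₀})`; (kill) at `ℓ ∈ T`; `a + ν + e ≤ m`, `2ν + e ≤ m`, `1 ≤ m`;
`κ` cyclotomic; `W`'s equation `p`-integral ((Γ) is discharged from file 55's (hB)).

References: [GreenbergLNM1716] §3–§4; [Kobayashi2003] Def. 2.1, Thm. 6.2, Prop. 8.7, Thm. 9.3;
[MilneADT2006] I Thm. 2.8, Lemma 3.3, Thm. 4.10; [SerreLocalFields1979] VII §5 Prop. 3;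
[SerreGaloisCohomology1997] I §2.4, II §1.1; [SilvermanAEC2009] VIII.§1–2, X.§4.
-/

noncomputable section

open scoped Classical

open CategoryTheory Field Function NumberField IsDedekindDomain WeierstrassCurve
open Literature.NumberTheory.EllipticCurves
open Literature.NumberTheory.GaloisRepresentations
open Literature.NumberTheory.GaloisRepresentations.DiscreteGaloisModule (SelmerStructure)
open Literature.NumberTheory.GaloisCohomology
open Literature.NumberTheory.EllipticCurves.Kobayashi2003
open Summit.BirchSwinnertonDyer.Rank1Residual.X11b.Levels
open Summit.BirchSwinnertonDyer.Rank1Residual.X11b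
open Summit.BirchSwinnertonDyer.Rank1Residual.Additive.DefectCountFiniteLevel
open Summit.BirchSwinnertonDyer.Rank1Residual.Additive.LocalModelTransport
open scoped ContRepresentation

-- Over `ℚ` two `ℚ`-algebra structures on a completion are in scope (`DivisionRing.toRatAlgebra` and the
-- completion's own); the tree's general-`K` statements (files 99/100/101–105: `Place.instAlgebraCompletion`,
-- which unfolds to the latter) must be met by the latter, so it is preferred locally (this file only;
-- the same device as file 78).
attribute [local instance 10000] IsDedekindDomain.HeightOneSpectrum.instAlgebraAdicCompletion
  NumberField.Place.instAlgebraCompletion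

namespace Summit.BirchSwinnertonDyer.Rank1Residual.Additive.LevelBridge

section Twist

variable (W : WeierstrassCurve ℚ) [W.IsElliptic] {p : ℕ} [hp : Fact p.Prime] (κ : ZpExtension ℚ p)
  {m : ℕ} [hint : (W.baseChange ℚ_[p]).IsIntegral ℤ_[p]]

/-- **THE COUNT (C) FOR THE `p*`-TWIST, ASSEMBLED: `[A₀ : S₀] = p^ν · ∏_{ℓ ∈ T} [𝓣_ℓ : 𝓚_ℓ]`.**
`W` is the `(−1)^{p/2}p`-twist of a globally minimal `V/ℚ` with good reduction at the odd prime `p`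
and `a_p(V) = 0`, with `p`-integral equation; `κ` is the cyclotomic `ℤ_p`-extension; `A₀ = Sel^{loc,∞}`
and `S₀ = Sel^{−,str}(E/K_0)` are read at the model `ℚ_[p]`.  The minus line at `v₀` is SUPPLIED
(B3 in level-`m` shape at `ℚ_[p]`, file 98, pulled back along the transport
`Θ : H¹(ℚ_{v₀}, W[p^m]) ↪ H¹(ℚ_p, W[p^m])` of files 101–105; `C = Θ⁻¹(Σ_p)`), and Tate's local
Euler–Poincaré characteristic is DISCHARGED (`localEulerPoincareCharacteristic_holds` at `ℚ_[p]` and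
at every `ℚ_v`).  CONDITIONAL on exactly: the NAMED FACT `poitouTate_selmerStructure_duality_real ℚ`
(`hPT`, Milne I 4.10 with the real place); the tower structure `𝓣` on `W[p^m]` (`h𝓣fin`, `h𝓣inf`)
and `𝒦_{v,0}[p^∞] = 0` off `T ∪ {v₀}` (`hT0`); `#A₀ ∣ p^a`; (MW) `P` generates `W(ℚ)/p^m` with order
`p^m`; (Ш) `Ш[p^m] ⊆ Ш[p^e]`; the exact level `ν` of `P` in `W(ℚ_{v₀})`; (kill)
`p^{m−2ν−e}𝓚_ℓ = 0` for `ℓ ∈ T`; `a + ν + e ≤ m`, `2ν + e ≤ m`, `1 ≤ m` ((Γ) `W[p^∞]^{Γ_ℚ} = 0` is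
DISCHARGED from file 55's `W[p^∞]^{Gal(ℚ̄/ℚ_∞)} = 0`).  Nothing about
(C1_η), (C2_η-GZ), (C3_η) as typed, or `BSD(W, p)`, is claimed; nothing booked.
[cite: Kobayashi2003, Def. 2.1 (p. 5), Thm. 6.2 (p. 11), Prop. 8.7 (p. 16), Thm. 9.3 (p. 26)]
[cite: GreenbergLNM1716, §4 (pp. 98–103)] [cite: MilneADT2006, Ch. I, Thm. 2.8, Lemma 3.3 and Thm. 4.10]
[cite: SerreLocalFields1979, VII §5 Prop. 3] -/
theorem relIndex_strictSignedSelmerLayer_localPreimage_eq_of_quadraticTwist_signedPrime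
    (hm : 1 ≤ m) (hp2 : p ≠ 2) (hκ : κ.IsCyclotomic) (Cv : VariableChange ℚ) (V : WeierstrassCurve ℚ)
    [V.IsElliptic] [V.IsGloballyMinimal] (hCV : Cv • W.quadraticTwist ((-1) ^ (p / 2) * p) = V)
    (hgood : V.HasGoodReductionAtPrime p) (hap : V.frobeniusTrace p = 0)
    -- the one fact-shaped input: Poitou–Tate duality with the real place
    (hPT : poitouTate_selmerStructure_duality_real ℚ)
    (v₀ : HeightOneSpectrum (𝓞 ℚ)) (hv₀ : (Rat.HeightOneSpectrum.primesEquiv (R := 𝓞 ℚ)).symm ⟨p, hp.out⟩ = v₀)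
    -- the tower structure and the exceptional set
    (T : Finset (HeightOneSpectrum (𝓞 ℚ))) (hv₀T : v₀ ∉ T)
    (𝓣 : SelmerStructure (W.torsionGaloisModule ((p ^ m : ℕ) : ℤ)))
    (h𝓣fin : ∀ v : HeightOneSpectrum (𝓞 ℚ), 𝓣 (Sum.inr v) =
      (W.localTowerKer κ (v.adicCompletion ℚ) 0).comap
        ((resH1Hom (Literature.NumberTheory.EllipticCurves.subgroupIncl
            (localSubgroup (κ.layerSubgroup 0) (v.adicCompletion ℚ)))
          (AddMonoidHom.id (localPoints W (v.adicCompletion ℚ))) (fun _ _ ↦ rfl)).comp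
          (galoisCohomology.map
            (W.torsionPointsMapIntertwining ((p ^ m : ℕ) : ℤ) (v.adicCompletion ℚ)) 1)))
    (h𝓣inf : ∀ w : InfinitePlace ℚ, 𝓣 (Sum.inl w) = W.kummerSelmerStructure ((p ^ m : ℕ) : ℤ) (Sum.inl w))
    (hT0 : ∀ v : HeightOneSpectrum (𝓞 ℚ), v ∉ T →
      v ≠ v₀ → W.localTowerKerPrimary κ (v.adicCompletion ℚ) 0 = ⊥)
    -- the size of `A₀`
    {ν eSha a : ℕ}
    (hA₀card : Nat.card ↥((W.selmerInfty κ ⊓ ⨅ σ : absoluteGaloisGroup ℚ,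
        (localKummerOverOfEmb W p κ.kerSubgroup (closureEmb (K := ℚ) ℚ_[p])
          (⨆ n, strictSignedLocalPoints κ ℚ_[p] W (-1) n)).comap
            (W.conjH1 p κ.kerSubgroup σ)).comap (W.layerToInfty κ 0)) ∣ p ^ a)
    -- (MW)
    (P : W.toAffine.Point)
    (hgen : ∀ Q : W.toAffine.Point, ∃ a : ℤ,
      Q - a • P ∈ (zsmulAddGroupHom ((p ^ m : ℕ) : ℤ) : W.toAffine.Point →+ _).range)
    (hord : ∀ a : ℤ, a • P ∈ (zsmulAddGroupHom ((p ^ m : ℕ) : ℤ) : W.toAffine.Point →+ _).range →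
      ((p ^ m : ℕ) : ℤ) ∣ a)
    -- (Ш)
    (hSha : ∀ c ∈ W.sha, ((p ^ m : ℕ) : ℤ) • c = 0 → p ^ eSha • c = 0)
    -- (loc): the exact level `ν` of `P` at `v₀`
    {Qv : (W.baseChange (v₀.adicCompletion ℚ)).toAffine.Point}
    (hPQ : p ^ ν • Qv = Affine.Point.baseChange (W' := W) ℚ (v₀.adicCompletion ℚ) P)
    (hexact : ∀ Q' : (W.baseChange (v₀.adicCompletion ℚ)).toAffine.Point,
      p ^ (ν + 1) • Q' ≠ Affine.Point.baseChange (W' := W) ℚ (v₀.adicCompletion ℚ) P)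
    -- (kill) at `ℓ ∈ T`
    (hkill : ∀ w ∈ T, ∀ x ∈ W.kummerSelmerStructure ((p ^ m : ℕ) : ℤ) (Sum.inr w),
      p ^ (m - (ν + eSha) - ν) • x = 0)
    (hnum : a + ν + eSha ≤ m) (hm2 : 2 * ν + eSha ≤ m) :
    (strictSignedSelmerLayer W κ ℚ_[p] (-1) 0).relIndex
        ((W.selmerInfty κ ⊓ ⨅ σ : absoluteGaloisGroup ℚ,
          (localKummerOverOfEmb W p κ.kerSubgroup (closureEmb (K := ℚ) ℚ_[p])
            (⨆ n, strictSignedLocalPoints κ ℚ_[p] W (-1) n)).comap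
              (W.conjH1 p κ.kerSubgroup σ)).comap (W.layerToInfty κ 0)) =
      p ^ ν * ∏ w ∈ T, (W.kummerSelmerStructure ((p ^ m : ℕ) : ℤ) (Sum.inr w)).relIndex (𝓣 (Sum.inr w)) := by
  haveI : NeZero (p ^ m) := ⟨pow_ne_zero m hp.out.ne_zero⟩
  have hpm1 : IsPrimePow (p ^ m) := (isPrimePow_nat_iff (p ^ m)).mpr ⟨p, m, hp.out, hm, rfl⟩
  have hn0 : (((p ^ m : ℕ) : ℤ)) ≠ 0 := by exact_mod_cast pow_ne_zero m hp.out.ne_zero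
  -- the Poitou–Tate family from `hPT`
  obtain ⟨inv, hperf, hvan, -, hcomp, hreal⟩ := exists_localInvariants_injective_inl_of_real hPT (p ^ m)
  -- Tate's local Euler characteristic, DISCHARGED at every `ℚ_v` and at `ℚ_[p]`
  have hEP : ∀ v : HeightOneSpectrum (𝓞 ℚ), localEulerPoincareCharacteristic (v.adicCompletion ℚ) :=
    fun v ↦ by
      haveI : CharZero (v.adicCompletion ℚ) :=
        Literature.NumberTheory.GaloisRepresentations.charZero_adicCompletion v
      exact localEulerPoincareCharacteristic_holds (v.adicCompletion ℚ)
  have hEPp : haveI : IsNonarchimedeanLocalField ℚ_[p] := Padic.isNonarchimedeanLocalField_holds p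
      localEulerPoincareCharacteristic ℚ_[p] := by
    haveI : IsNonarchimedeanLocalField ℚ_[p] := Padic.isNonarchimedeanLocalField_holds p
    exact localEulerPoincareCharacteristic_holds ℚ_[p]
  have hvp : (Rat.HeightOneSpectrum.primesEquiv v₀ : ℕ) = p := by
    rw [← hv₀, Equiv.apply_symm_apply]
  -- the two models `E' = ℚ_{v₀}` (literally `Place.Completion (Sum.inr v₀)`) and `E = ℚ_[p]`
  obtain ⟨e⟩ : Nonempty (ℚ_[p] ≃A[ℚ] v₀.adicCompletion ℚ) := by
    subst hv₀
    exact ⟨Padic.adicCompletionEquiv (𝓞 ℚ) ⟨p, hp.out⟩⟩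
  -- (the four instances are registered under both spellings of `ℚ_{v₀}`: `v₀.adicCompletion ℚ` for the
  -- count of file 100, `Place.Completion (Sum.inr v₀)` for the transport of files 101–105)
  letI iA₀ : Algebra (v₀.adicCompletion ℚ) ℚ_[p] :=
    ((e.symm : v₀.adicCompletion ℚ ≃A[ℚ] ℚ_[p]) : v₀.adicCompletion ℚ →ₐ[ℚ] ℚ_[p]).toRingHom.toAlgebra
  letI iA : Algebra (Place.Completion (Sum.inr v₀ : Place ℚ)) ℚ_[p] := iA₀
  haveI iT₀ : IsScalarTower ℚ (v₀.adicCompletion ℚ) ℚ_[p] :=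
    IsScalarTower.of_algebraMap_eq fun q ↦
      (((e.symm : v₀.adicCompletion ℚ ≃A[ℚ] ℚ_[p]) : v₀.adicCompletion ℚ →ₐ[ℚ] ℚ_[p]).commutes q).symm
  haveI : IsScalarTower ℚ (Place.Completion (Sum.inr v₀ : Place ℚ)) ℚ_[p] := iT₀
  letI iA₀' : Algebra ℚ_[p] (v₀.adicCompletion ℚ) :=
    ((e : ℚ_[p] ≃A[ℚ] v₀.adicCompletion ℚ) : ℚ_[p] →ₐ[ℚ] v₀.adicCompletion ℚ).toRingHom.toAlgebra
  letI iA' : Algebra ℚ_[p] (Place.Completion (Sum.inr v₀ : Place ℚ)) := iA₀'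
  haveI iT₀' : IsScalarTower ℚ ℚ_[p] (v₀.adicCompletion ℚ) :=
    IsScalarTower.of_algebraMap_eq fun q ↦
      (((e : ℚ_[p] ≃A[ℚ] v₀.adicCompletion ℚ) : ℚ_[p] →ₐ[ℚ] v₀.adicCompletion ℚ).commutes q).symm
  haveI : IsScalarTower ℚ ℚ_[p] (Place.Completion (Sum.inr v₀ : Place ℚ)) := iT₀'
  have hsurj : Function.Surjective (algebraMap (Place.Completion (Sum.inr v₀ : Place ℚ)) ℚ_[p]) :=
    (e.symm : v₀.adicCompletion ℚ ≃A[ℚ] ℚ_[p]).surjective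
  haveI : Module.Finite (Place.Completion (Sum.inr v₀ : Place ℚ)) ℚ_[p] :=
    Module.Finite.of_surjective (Algebra.linearMap (Place.Completion (Sum.inr v₀ : Place ℚ)) ℚ_[p]) hsurj
  haveI : Algebra.IsAlgebraic (Place.Completion (Sum.inr v₀ : Place ℚ)) ℚ_[p] := inferInstance
  haveI : CharZero (Place.Completion (Sum.inr v₀ : Place ℚ)) :=
    Literature.NumberTheory.GaloisRepresentations.charZero_adicCompletion v₀
  -- (htors) for the twist (file 55), at `ℚ_[p]` in both readings and at `ℚ_{v₀}`
  obtain ⟨M₀, hΔ, hA, hVM₀⟩ := exists_goodSupersingularPadicModel hp2 V hgood hap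
  have hc := sq_ne_neg_one_pow_mul_prime hp.out (p / 2)
  have htorsE := eq_zero_of_prime_pow_smul_eq_zero_localFixedPointsOfEmb_kerSubgroup_of_quadraticTwist κ
    (closureEmb (K := ℚ) ℚ_[p]) hp2 W hc Cv hCV M₀ hΔ hA hVM₀
  have htorsX := eq_zero_of_prime_smul_eq_zero_padic_of_quadraticTwist_signedPrime hp2 W Cv hCV M₀ hΔ hA hVM₀
  have htors : ∀ X : (W.baseChange (v₀.adicCompletion ℚ)).toAffine.Point,
      p • X = 0 → X = 0 := fun X hX ↦
    eq_zero_of_smul_eq_zero_point_of_localFixedPoints W p (v₀.adicCompletion ℚ) ℚ_[p]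
      ((e.symm : v₀.adicCompletion ℚ ≃A[ℚ] ℚ_[p]) : v₀.adicCompletion ℚ →ₐ[ℚ] ℚ_[p]) κ.kerSubgroup htorsE
      (j := 1) X (by rwa [pow_one])
  have hΓE := forall_fixed_eq_zero_of_localFixedPoints W p ℚ_[p] κ.kerSubgroup htorsE
  -- (Γ) `W[p^∞]^{Γ_ℚ} = 0`, DISCHARGED from (hB) `W[p^∞]^{Gal(ℚ̄/ℚ_∞)} = 0` (file 55)
  have hΓ : ∀ Q : W.geomPrimaryTorsion p,
      (∀ σ : absoluteGaloisGroup ℚ, X11b.LocBridge.primaryGaloisModule W p σ Q = Q) → Q = 0 := by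
    intro Q hQ
    have hmem : Q ∈ FixedPoints.addSubgroup κ.kerSubgroup (W.geomPrimaryTorsion p) := by
      rw [FixedPoints.mem_addSubgroup]
      intro σ
      exact hQ σ
    rw [fixedPoints_kerSubgroup_geomPrimaryTorsion_eq_bot_of_quadraticTwist κ hp2 W hc Cv hCV M₀ hΔ hA
      hVM₀] at hmem
    exact (AddSubgroup.mem_bot).mp hmem
  -- the good supersingular `ℤ_p`-model in the Honda–Kobayashi binders, and `ℚ(μ_p)`
  obtain ⟨M, hM1, hM2, htr, hVM⟩ := exists_padicModel_tr_eq_zero V hgood hap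
  haveI := hM1
  haveI := hM2
  haveI : NeZero p := ⟨hp.out.ne_zero⟩
  haveI hcycF : IsCyclotomicExtension {p} ℚ (CyclotomicField p ℚ) := by
    have h : (CyclotomicField.algebra p ℚ : Algebra ℚ (CyclotomicField p ℚ)) = DivisionRing.toRatAlgebra :=
      Subsingleton.elim _ _
    exact h ▸ CyclotomicField.isCyclotomicExtension p ℚ
  -- B3 in level-`m` shape at `ℚ_[p]`, at every layer `n' ≥ 2m − 1`
  set Sg : ℕ → AddSubgroup (galoisCohomology
      (GaloisRep.restrictField ℚ_[p] (W.torsionGaloisModule ((p ^ m : ℕ) : ℤ))) 1) := fun n' ↦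
    AddSubgroup.closure {ξ | ∃ x ∈ signedLocalPointsOfEmb κ (closureEmb (K := ℚ) ℚ_[p]) W (-1) n' ⊓
          (localTraceOfEmb κ (closureEmb (K := ℚ) ℚ_[p]) W 0 n').ker,
        ∃ R : localPoints W ℚ_[p], ((p ^ m : ℕ) : ℤ) • R = x ∧
        ∃ φ : contOneCocycles (DiscreteGaloisModule.toTopRep
            (GaloisRep.restrictField ℚ_[p] (W.torsionGaloisModule ((p ^ m : ℕ) : ℤ)))),
          oneCocycleClass _ φ = ξ ∧
          ∀ u ∈ localLayerSubgroupOfEmb κ (closureEmb (K := ℚ) ℚ_[p]) n',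
            pointsMap W ℚ_[p] ((φ.1 u : geomTorsion W ((p ^ m : ℕ) : ℤ)) : geomPoints W) = u • R - R}
    with hSg
  have hB3 : ∀ n' : ℕ, 2 * m ≤ n' + 1 →
      Sg n' ⊔ (W.localKummerMap ℚ_[p] hn0).range = ⊤ ∧ Nat.card (Sg n') = p ^ m ∧
      Nat.card (galoisCohomology
          (GaloisRep.restrictField ℚ_[p] (W.torsionGaloisModule ((p ^ m : ℕ) : ℤ))) 1) = p ^ (2 * m) ∧
      ∃ s ∈ Sg n', addOrderOf s = p ^ m := fun n' hn' ↦
    SignedTwist.closure_minus_sup_range_localKummerMap_eq_top_of_localEuler W κ (CyclotomicField p ℚ)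
      hp2 hκ Cv hCV M htr hVM hn' hEPp
  set n := 2 * m with hn
  obtain ⟨hsup, hS, hH, hcyc⟩ := hB3 n (by omega)
  haveI hBfin : Finite (galoisCohomology
      (GaloisRep.restrictField ℚ_[p] (W.torsionGaloisModule ((p ^ m : ℕ) : ℤ))) 1) :=
    SignedTwist.finite_galoisCohomology_torsion_padic W hn0
  -- the minus lines of all layers `n' ≥ n` coincide
  have hSgeq : ∀ n', n ≤ n' → Sg n = Sg n' := fun n' hnn' ↦ by
    refine AddSubgroup.eq_of_le_of_card_ge (closure_minus_mono W κ ℚ_[p] hnn') ?_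
    rw [hS, (hB3 n' (by omega)).2.1]
  -- the transport `Θ : H¹(ℚ_{v₀}, W[p^m]) → H¹(ℚ_p, W[p^m])`
  obtain ⟨τ, hτemb⟩ := exists_smul_absClosureEmbedding_eq ℚ (Place.Completion (Sum.inr v₀ : Place ℚ)) ℚ_[p]
  have hτ := absGaloisRestrict_absGaloisRestrict_eq_conj ℚ (Place.Completion (Sum.inr v₀ : Place ℚ)) ℚ_[p] hτemb
  have hr : Function.Surjective (absGaloisRestrict (Place.Completion (Sum.inr v₀ : Place ℚ)) ℚ_[p]) :=
    absGaloisRestrict_surjective_of_surjective _ _ hsurj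
  obtain ⟨Θ, hΘres, hΘcoc, hΘinj⟩ :=
    exists_transportH1 (W.torsionGaloisModule ((p ^ m : ℕ) : ℤ)) (Place.Completion (Sum.inr v₀ : Place ℚ))
      ℚ_[p] hτ
  have hinj := hΘinj hr
  -- `#H¹(ℚ_{v₀}, W[p^m]) = p^{2m} = #H¹(ℚ_p, W[p^m])`
  have hcardA : Nat.card (galoisCohomology ((W.torsionGaloisModule ((p ^ m : ℕ) : ℤ)).toLocal
      (Sum.inr v₀)) 1) = Nat.card (galoisCohomology
        (GaloisRep.restrictField ℚ_[p] (W.torsionGaloisModule ((p ^ m : ℕ) : ℤ))) 1) := by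
    rw [hH]
    change Nat.card (galoisCohomology (GaloisRep.restrictField (v₀.adicCompletion ℚ)
      (W.torsionGaloisModule ((p ^ m : ℕ) : ℤ))) 1) = _
    rw [natCard_galoisCohomology_one_torsion_adicCompletion_eq_sq W v₀ (p ^ m) hpm1 (hEP v₀),
      natCard_ker_nsmul_pow_eq_one htors m, one_mul, natCard_quot_adicCompletionIntegers_prime_pow_rat hvp m,
      ← pow_mul, mul_comm]
  -- the Kummer groups: `Θ(𝓚_{v₀}) = 𝓚_p`
  have hKp : Nat.card (W.kummerLocalConditionAt ((p ^ m : ℕ) : ℤ) ℚ_[p]) = p ^ m := by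
    rw [← range_localKummerMap W ℚ_[p] hn0]
    exact (SignedTwist.natCard_range_localKummerMap W htorsX m).1
  have hKv : Nat.card (W.kummerLocalConditionAt ((p ^ m : ℕ) : ℤ) (Place.Completion (Sum.inr v₀ : Place ℚ))) =
      p ^ m := by
    change Nat.card (W.kummerSelmerStructure ((p ^ m : ℕ) : ℤ) (Sum.inr v₀)) = _
    rw [natCard_kummerSelmerStructure_inr W v₀ (NeZero.ne (p ^ m)), natCard_ker_nsmul_pow_eq_one htors m,
      one_mul, natCard_quot_adicCompletionIntegers_prime_pow_rat hvp m]
  have hK : (W.kummerSelmerStructure ((p ^ m : ℕ) : ℤ) (Sum.inr v₀)).map Θ = (W.localKummerMap ℚ_[p] hn0).range := by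
    rw [range_localKummerMap W ℚ_[p] hn0]
    exact map_kummerLocalConditionAt_eq W (Place.Completion (Sum.inr v₀ : Place ℚ)) ℚ_[p] _ hτemb Θ hΘcoc
      hinj (hKv.trans hKp.symm)
  -- THE MINUS LINE AT `v₀`
  set C := (Sg n).comap Θ with hC
  obtain ⟨hCcard, hCcyc, hCL⟩ := comap_line_shape Θ hinj hcardA (Sg n) _
    (W.kummerSelmerStructure ((p ^ m : ℕ) : ℤ) (Sum.inr v₀)) hK hsup hS hcyc
  -- `hCT`: the pulled-back line satisfies the tower condition (file 105)
  have hCT : C ≤ 𝓣 (Sum.inr v₀) := by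
    intro ξ' hξ'
    rw [h𝓣fin v₀]
    exact AddSubgroup.mem_comap.mpr (comp_map_mem_localTowerKer_of_mem_comap W κ
      (Place.Completion (Sum.inr v₀ : Place ℚ)) ℚ_[p] n 0 hτemb hτ hr Θ hΘcoc (AddSubgroup.mem_comap.mp hξ'))
  -- `hLC`: localisations of `Ψ_m⁻¹ A₀` lie on the line (files 86, §1, coincidence of the lines)
  have htorsL : ∀ n', ∀ Q ∈ localLayerPointsOfEmb κ (closureEmb (K := ℚ) ℚ_[p]) W n', p • Q = 0 → Q = 0 :=
    fun n' Q hQ hpQ ↦ htorsE Q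
      (localFixedPointsOfEmb_antitone (closureEmb (K := ℚ) ℚ_[p]) W (κ.kerSubgroup_le_layerSubgroup n') hQ)
      ⟨1, by rwa [pow_one]⟩
  have htorsInf : ∀ Q ∈ localFixedPointsOfEmb (closureEmb (K := ℚ) ℚ_[p]) W κ.kerSubgroup,
      ∀ j : ℕ, p ^ j • Q = 0 → Q = 0 := fun Q hQ j hj ↦ htorsE Q hQ ⟨j, hj⟩
  have hLC : ∀ c : galoisCohomology (W.torsionGaloisModule ((p ^ m : ℕ) : ℤ)) 1,
      resH1Hom (Literature.NumberTheory.EllipticCurves.subgroupIncl (κ.layerSubgroup 0))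
        (AddMonoidHom.id (geomPrimaryTorsion W p))
        (fun _ _ ↦ rfl) (galoisCohomology.map (primaryInclusion W p m) 1 c) ∈
        (W.selmerInfty κ ⊓ ⨅ σ : absoluteGaloisGroup ℚ,
            (localKummerOverOfEmb W p κ.kerSubgroup (closureEmb (K := ℚ) ℚ_[p])
              (⨆ n, strictSignedLocalPoints κ ℚ_[p] W (-1) n)).comap
              (W.conjH1 p κ.kerSubgroup σ)).comap (W.layerToInfty κ 0) →
      galoisCohomology.localization (W.torsionGaloisModule ((p ^ m : ℕ) : ℤ)) (Sum.inr v₀) 1 c ∈ C := by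
    intro c hc
    -- the signed component at `σ = 1`, in `h_0`-form
    have hc1 : resH1Hom (Literature.NumberTheory.EllipticCurves.subgroupIncl κ.kerSubgroup)
        (AddMonoidHom.id (geomPrimaryTorsion W p))
        (fun _ _ ↦ rfl) (galoisCohomology.map (primaryInclusion W p m) 1 c) ∈
        localKummerOverOfEmb W p κ.kerSubgroup (closureEmb (K := ℚ) ℚ_[p])
          (⨆ n, strictSignedLocalPointsOfEmb κ (closureEmb (K := ℚ) ℚ_[p]) W (-1) n) := by
      have h := (AddSubgroup.mem_iInf.mp (AddSubgroup.mem_inf.mp (AddSubgroup.mem_comap.mp hc)).2) 1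
      rw [AddSubgroup.mem_comap, W.conjH1_one_holds p κ.kerSubgroup, AddMonoidHom.id_apply,
        layerToInfty_levelToLayerZero_eq] at h
      exact h
    obtain ⟨n₁, x, hx, R, hR, φ, hφ, hφu⟩ :=
      exists_kummer_cocycle_of_mem_localKummerOverOfEmb_iSup_strictSigned W p m ℚ_[p] κ htorsL htorsInf c hc1
    have hmem : galoisCohomology.res (W.torsionGaloisModule ((p ^ m : ℕ) : ℤ)) ℚ_[p] 1 c ∈ Sg (max n n₁) :=
      closure_minus_mono W κ ℚ_[p] (le_max_right n n₁)
        (mem_closure_minus_of_strictSigned_kummer W κ ℚ_[p] n₁ htorsInf hx hR φ hφ.symm hφu)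
    rw [← hSgeq (max n n₁) (le_max_left n n₁)] at hmem
    rw [hC]
    change Θ (galoisCohomology.res (W.torsionGaloisModule ((p ^ m : ℕ) : ℤ))
      (Place.Completion (Sum.inr v₀ : Place ℚ)) 1 c) ∈ Sg n
    rw [hΘres c]
    exact hmem
  -- `hCdet`: the line detects the signed condition (files 94, 85)
  have hCdet : ∀ c : galoisCohomology (W.torsionGaloisModule ((p ^ m : ℕ) : ℤ)) 1,
      resH1Hom (Literature.NumberTheory.EllipticCurves.subgroupIncl (κ.layerSubgroup 0))
        (AddMonoidHom.id (geomPrimaryTorsion W p))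
        (fun _ _ ↦ rfl) (galoisCohomology.map (primaryInclusion W p m) 1 c) ∈ W.selmerInftyPreimage κ 0 →
      galoisCohomology.localization (W.torsionGaloisModule ((p ^ m : ℕ) : ℤ)) (Sum.inr v₀) 1 c ∈ C →
      resH1Hom (Literature.NumberTheory.EllipticCurves.subgroupIncl (κ.layerSubgroup 0))
        (AddMonoidHom.id (geomPrimaryTorsion W p))
        (fun _ _ ↦ rfl) (galoisCohomology.map (primaryInclusion W p m) 1 c) ∈
        (⨅ σ : absoluteGaloisGroup ℚ,
            (localKummerOverOfEmb W p κ.kerSubgroup (closureEmb (K := ℚ) ℚ_[p])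
              (⨆ n, strictSignedLocalPoints κ ℚ_[p] W (-1) n)).comap
              (W.conjH1 p κ.kerSubgroup σ)).comap (W.layerToInfty κ 0) := by
    intro c _ hloc
    rw [hC] at hloc
    change Θ (galoisCohomology.res (W.torsionGaloisModule ((p ^ m : ℕ) : ℤ))
      (Place.Completion (Sum.inr v₀ : Place ℚ)) 1 c) ∈ Sg n at hloc
    rw [hΘres c] at hloc
    obtain ⟨x, hx, R, hR, φ, hφ, hφu⟩ := SignedTwist.minus_of_mem_closure W κ ℚ_[p] n hloc
    have hRA : p ^ m • R ∈ ⨆ n', strictSignedLocalPoints κ ℚ_[p] W (-1) n' := by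
      rw [← natCast_zsmul, hR]
      exact le_iSup (fun n' ↦ strictSignedLocalPoints κ ℚ_[p] W (-1) n') n
        ⟨(AddSubgroup.mem_inf.mp hx).1, fun _ ↦ by
          rw [(AddMonoidHom.mem_ker).mp (AddSubgroup.mem_inf.mp hx).2]; exact zero_mem _⟩
    exact levelToLayerZero_mem_comap_iInf_localKummerOverOfEmb_of_res_eq W p m ℚ_[p] κ _ c φ hφ.symm
      hRA le_rfl n hφu
  -- `p^m A₀ = 0`-type input is `#A₀ ∣ p^a`; the classical `DecidableEq ℚ` of the general-`K` files
  have hinst : (instDecidableEqRat : DecidableEq ℚ) = fun a b => Classical.propDecidable (a = b) :=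
    Subsingleton.elim _ _
  rw [hinst] at hgen hord
  exact relIndex_strictSignedSelmerLayer_localPreimage_eq_of_minusLine W κ hm inv hperf hvan hcomp
    hreal hEP v₀ (natCard_quot_adicCompletionIntegers_prime_pow_rat hvp m) ℚ_[p] hΓE T hv₀T 𝓣 h𝓣fin
    h𝓣inf hT0 C hCT hCcard hCcyc hLC hCdet hA₀card (zsmul_geomPoints_surjective_holds W) P hgen hord
    hSha hΓ htors hPQ hexact hCL hkill hnum hm2

end Twist

-- (x1b GEN 43: proof-neutral re-land to re-enqueue the module build on the farm — the consumer is file 108,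
-- `DefectCountSignedTwistSelmerSide.lean`, p370455, deferred 40× on `…DefectCountSignedTwistAssembly:no-olean`;
-- no declaration changed.)

end Summit.BirchSwinnertonDyer.Rank1Residual.Additive.LevelBridge

end
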